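import Summits.ResolutionOfSingularities.ResolutionOfSingularities.Theorems.DeltaCutGradeCertificates3
import HarnessLib

/-!
# MirrorBarrier — decomp-res lens-6 g29 NODE «MirrorCut», kernel part (iv): the INDUCTION SKELETON of the barrier theorem

HOME file `decomp-res-lens-6/g29/MirrorBarrier.lean` (companion of `MirrorCut.lean` / `MirrorRigidity.lean`; same
imports and namespace; section
`MBarrier`).  PURE LOGIC, said up front: this file isolates the SHAPE of the barrier argument (NODE-g29.md §2 (iv))
as a kernel theorem about an
abstract one-centre dynamics.  A memoryless one-centre law `ℓ` on stages either stops or names one admissible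
centre; its run blows that centre
up and repeats.  A MIRROR WITNESS for `ℓ` at `X₀` is an invariant of stages — in the tree: «contains an open
sub-stage isomorphic to the
`D′`-stage `X₀` through a top point, on which `ℓ` is the transported `ℓ(X₀)`» — that holds at `X₀`, forces a
nonempty top locus, and is
reproduced by the law's own blow-up.  THEN the run of `ℓ` from `X₀` never terminates resolved: it FREEZES (stops
with nonempty top locus) or
CYCLES (never stops) — `mirror_barrier`, `mirror_freezes_or_cycles`.

Where the mathematics is: discharging `MirrorWitness` for the tree's refined-stage dynamics is exactly (ii) RIGIDITY
(`MirrorRigidity.lean`: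
`ℓ(X₀) ∈ {stop, L}`) + (iii) SELF-REPRODUCTION (`MirrorCut.lean` §A: the charts of `Bl_L` are `D′` again / carry no
top point) + the
equivariance-and-locality axiom (e) of the class 𝓜 — the (B1)/(B2) typing left to g30 (NODE-g29.md §8).  [new;
elementary] [folklore]
-/


noncomputable section

open CategoryTheory CategoryTheory.Limits AlgebraicGeometry TopologicalSpace IsLocalRing
open Literature.AlgebraicGeometry.Resolution

universe u

namespace Summit.ResolutionOfSingularities.ResolutionOfSingularities.Theorems.DeltaCutClasses

section MBarrier

/-- **ONE-CENTRE DYNAMICS**: a type of stages, the predicate «the top locus `E_{=n}` is nonempty», the admissible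
centres at each stage, and the
blow-up of a stage in an admissible centre (controlled transform, law-state reset). DEFINITION (support). -/
structure OneCentreDynamics where
  /-- the stages -/
  Stage : Type u
  /-- the top locus of the stage is nonempty -/
  TopNonempty : Stage → Prop
  /-- the admissible (nonempty, regular, inside the top locus) centres at a stage -/
  Centre : Stage → Type u
  /-- blowing up an admissible centre -/
  blowup : (X : Stage) → Centre X → Stage

variable {𝓓 : OneCentreDynamics.{u}}

/-- a MEMORYLESS ONE-CENTRE LAW: at each stage, «stop» (`none`) or ONE admissible centre — a function of the stage
alone. DEFINITION (support). -/
def OneCentreDynamics.Law (𝓓 : OneCentreDynamics.{u}) : Type u := (X : 𝓓.Stage) → Option (𝓓.Centre X)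

/-- one step of the run of `ℓ`: stay put after «stop», else blow up the named centre. DEFINITION (support). -/
def OneCentreDynamics.step (𝓓 : OneCentreDynamics.{u}) (ℓ : 𝓓.Law) (X : 𝓓.Stage) : 𝓓.Stage :=
  match ℓ X with
  | none => X
  | some c => 𝓓.blowup X c

/-- the RUN of `ℓ` from `X`. DEFINITION (support). -/
def OneCentreDynamics.run (𝓓 : OneCentreDynamics.{u}) (ℓ : 𝓓.Law) (X : 𝓓.Stage) : ℕ → 𝓓.Stage
  | 0 => X
  | k + 1 => 𝓓.step ℓ (OneCentreDynamics.run 𝓓 ℓ X k)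

/-- the run TERMINATES RESOLVED: at some step the law stops at a stage whose top locus is empty. DEFINITION (support). -/
def OneCentreDynamics.TerminatesResolved (𝓓 : OneCentreDynamics.{u}) (ℓ : 𝓓.Law) (X : 𝓓.Stage) : Prop :=
  ∃ k, ℓ (𝓓.run ℓ X k) = none ∧ ¬ 𝓓.TopNonempty (𝓓.run ℓ X k)

/-- the run FREEZES: at some step the law stops at a stage whose top locus is NONEMPTY. DEFINITION (support). -/
def OneCentreDynamics.Freezes (𝓓 : OneCentreDynamics.{u}) (ℓ : 𝓓.Law) (X : 𝓓.Stage) : Prop :=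
  ∃ k, ℓ (𝓓.run ℓ X k) = none ∧ 𝓓.TopNonempty (𝓓.run ℓ X k)

/-- the run CYCLES: the law never stops. DEFINITION (support). -/
def OneCentreDynamics.Cycles (𝓓 : OneCentreDynamics.{u}) (ℓ : 𝓓.Law) (X : 𝓓.Stage) : Prop :=
  ∀ k, ℓ (𝓓.run ℓ X k) ≠ none

/-- **MIRROR WITNESS for a law `ℓ` at a stage `X₀`**: an invariant `Mirrors` of stages holding at `X₀`, forcing a
nonempty top locus, and reproduced
by the law's own blow-up.  In the tree (NODE-g29.md §2): `Mirrors X` := «`X` has an open sub-stage `U ≅ X₀` meeting `E_{=n}(X)` with `ℓ(X)|_U` = the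
transported `ℓ(X₀)`»; `start` is trivial, `top` is (i), `reproduce` is RIGIDITY (ii) (`ℓ(X₀) = L` once `ℓ(X₀) ≠
stop`) + SELF-REPRODUCTION (iii) +
locality/equivariance (e). DEFINITION (support). -/
structure MirrorWitness (ℓ : 𝓓.Law) (X₀ : 𝓓.Stage) where
  /-- the reproduced invariant -/
  Mirrors : 𝓓.Stage → Prop
  /-- it holds at the start -/
  start : Mirrors X₀
  /-- it forces a nonempty top locus -/
  top : ∀ X, Mirrors X → 𝓓.TopNonempty X
  /-- it survives the law's own blow-up -/
  reproduce : ∀ (X : 𝓓.Stage) (c : 𝓓.Centre X), Mirrors X → ℓ X = some c → Mirrors (𝓓.blowup X c)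

variable {ℓ : 𝓓.Law} {X₀ : 𝓓.Stage}

/-- the invariant survives one step of the run. [elementary] [folklore] -/
theorem MirrorWitness.mirrors_step (W : MirrorWitness ℓ X₀) {X : 𝓓.Stage} (hX : W.Mirrors X) : W.Mirrors (𝓓.step ℓ X) := by
  unfold OneCentreDynamics.step
  cases h : ℓ X with
  | none => simpa using hX
  | some c => simpa using W.reproduce X c hX h

/-- **INDUCTION (iv)**: every stage of the run carries the invariant. [new; elementary] [folklore] -/
theorem MirrorWitness.mirrors_run (W : MirrorWitness ℓ X₀) : ∀ k, W.Mirrors (𝓓.run ℓ X₀ k)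
  | 0 => W.start
  | k + 1 => W.mirrors_step (MirrorWitness.mirrors_run W k)

/-- every stage of the run has a nonempty top locus. [new; elementary] [folklore] -/
theorem MirrorWitness.topNonempty_run (W : MirrorWitness ℓ X₀) (k : ℕ) : 𝓓.TopNonempty (𝓓.run ℓ X₀ k) :=
  W.top _ (W.mirrors_run k)

/-- **THE BARRIER (abstract form)**: a law with a mirror witness at `X₀` does not terminate resolved from `X₀`.
[new; elementary] [folklore] -/
theorem mirror_barrier (W : MirrorWitness ℓ X₀) : ¬ 𝓓.TerminatesResolved ℓ X₀ := by
  rintro ⟨k, -, hk⟩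
  exact hk (W.topNonempty_run k)

/-- **FREEZES OR CYCLES**: a law with a mirror witness at `X₀` either stops at a stage with nonempty top locus or
never stops. [new; elementary]
[folklore] -/
theorem mirror_freezes_or_cycles (W : MirrorWitness ℓ X₀) : 𝓓.Freezes ℓ X₀ ∨ 𝓓.Cycles ℓ X₀ := by
  classical
  by_cases h : ∃ k, ℓ (𝓓.run ℓ X₀ k) = none
  · obtain ⟨k, hk⟩ := h
    exact Or.inl ⟨k, hk, W.topNonempty_run k⟩
  · right
    intro k hk
    exact h ⟨k, hk⟩

/-- the three letters are exhaustive and «terminates resolved» excludes the other two readings at the stopping step: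
a frozen or cycling run
is not resolved-terminating when stops are permanent (after «stop» the run stays put, so the top locus at every
later step is the frozen one).
[elementary] [folklore] -/
theorem OneCentreDynamics.run_succ_of_stop {X : 𝓓.Stage} {k : ℕ} (h : ℓ (𝓓.run ℓ X k) = none) :
    𝓓.run ℓ X (k + 1) = 𝓓.run ℓ X k := by
  show 𝓓.step ℓ (𝓓.run ℓ X k) = _
  unfold OneCentreDynamics.step
  rw [h]

end MBarrier

end Summit.ResolutionOfSingularities.ResolutionOfSingularities.Theorems.DeltaCutClasses
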